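import Mathlib
import HarnessLib
import HarnessLib.Audit
import Summits.CriticalPhenomena.Statement
import Literature.Probability.RandomPlanarGeometry.HexSAW
import Literature.Probability.RandomPlanarGeometry.ChordalCurveFamily
import Literature.Probability.RandomPlanarGeometry.ConformalMap
import HarnessLib.Audit.Status.Attr

/-!
Route: SAWBrickWallHomotopy

DORMANT since 2026-08-26T05:04:02Z (reconciler: no traction for 8.4 d (last activity item-evidence-added at 2026-08-17T19:39:23Z); parked, not closed — `ledger route dormant route-CriticalPhenomena-SAWBrickWallHomotopy --off` to reactiv) — unstaffed, not closed; items shared with open routes are served there. `ledger route dormant <id> --off` reactivates.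

# Route SAWBrickWallHomotopy — honeycomb inside Z2 — hex universality modulo a diagonal modulus,
pinned by the quarter-turn

It suffices to show X = (H) ∧ (LMU) (card honeycomb-inside-z2-weight-homotopy, which absorbed
polymer-stress-tensor-ward):
(H) HexConjecture — Duminil-Copin–Smirnov Conjecture 1 (critical hexagonal SAW → chordal SLE_8/3),
the unproved named fact
Literature.Probability.RandomPlanarGeometry.SAW.HexSAWScalingLimit restated verbatim as in route
SAWHexUniversality (shared item, listed first);
(LMU) ModulusUniversality — linear-modulus universality: there is ONE diagonal map Φ = diag(r₁, r₂),
r₁, r₂ > 0, such that for every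
Dobrushin domain D and every square-lattice endpoint approximation, the critical δℤ² SAW law in D
and the Φ-image of the critical δ-hexagonal
SAW law in Φ⁻¹(D) (for some hexagonal endpoint approximation) become asymptotically equal on bounded
continuous test functions as δ → 0+.
No value of the modulus r₂/r₁ is asserted. The Assembly kills it: the exact quarter-turn symmetry of
the ℤ² walk makes diag(1,(r₂/r₁)²) a
covariance of the chordal SLE_8/3 family, and SLE_8/3 has no axis-stretch covariance (support
StretchRigidity), so Φ is a similarity and
the ℤ² limit is SLE_8/3. The card's one-graph weight homotopy (honeycomb = brick wall BW ⊂ ℤ²,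
weights x_c(t)^|γ| t^N_odd, t ∈ [0,1]) and its
fluctuation–response (Ward) identity are the proposed ENGINE of (LMU): crux BrickWallFlow (the law
is transported modulo a diagonal modulus
along t) and crux OddBondDensity (the score of the exponential family is a centred pattern count:
N_odd/|γ| → 1/4).
Lean: `(∀ (D : Literature.Probability.RandomPlanarGeometry.DobrushinDomain) (a b : ℝ →
Literature.Probability.LatticeModels.HexVertex),
Literature.Probability.RandomPlanarGeometry.SAW.IsEmbEndpointApprox
Literature.Probability.LatticeModels.hexGraph Literature.Probability.LatticeModels.hexCenter D a b →
Literature.Probability.RandomPlanarGeometry.ConvergesInLawToSLE ((8 : NNReal) / 3) D (fun δ (γ :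
Literature.Probability.RandomPlanarGeometry.SAW.HexDomainSAW D.carrier δ (a δ) (b δ)) => γ.curve)
(fun δ => Literature.Probability.RandomPlanarGeometry.SAW.hexSAWLaw D.carrier δ (a δ) (b δ))) ∧ (∃
r₁ r₂ : ℝ, 0 < r₁ ∧ 0 < r₂ ∧ ∀ Φ : ℂ ≃ₜ ℂ, (∀ z : ℂ, Φ z = ((r₁ * z.re : ℝ) : ℂ) + ((r₂ * z.im : ℝ)
: ℂ) * Complex.I) → ∀ (D : Literature.Probability.RandomPlanarGeometry.DobrushinDomain) (a b : ℝ →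
Literature.Probability.LatticeModels.Site 2),
Literature.Probability.RandomPlanarGeometry.SAW.IsEndpointApprox D a b → ∃ a' b' : ℝ →
Literature.Probability.LatticeModels.HexVertex,
Literature.Probability.RandomPlanarGeometry.SAW.IsEmbEndpointApprox
Literature.Probability.LatticeModels.hexGraph Literature.Probability.LatticeModels.hexCenter (D.map
Φ.symm) a' b' ∧ ∀ f : BoundedContinuousFunction
(Literature.Probability.RandomPlanarGeometry.CurveClass ℂ) ℝ, Filter.Tendsto (fun δ => (∫ γ, f
γ.curve ∂(Literature.Probability.RandomPlanarGeometry.SAW.law D.carrier δ (a δ) (b δ))) - ∫ γ, f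
(Literature.Probability.RandomPlanarGeometry.CurveClass.map (Φ : C(ℂ, ℂ)) γ.curve)
∂(Literature.Probability.RandomPlanarGeometry.SAW.hexSAWLaw (D.map Φ.symm).carrier δ (a' δ) (b' δ)))
(nhdsWithin 0 (Set.Ioi 0)) (nhds 0))`

## Assembly
Checked on paper against the tree's API (Sketch.lean elaborates all decls, rc 0). Fix D and a ℤ²
endpoint approximation. ModulusUniversality gives r₁, r₂, Φ and a hexagonal approximation of Φ⁻¹(D);
HexConjecture there gives TendstoLaw to an SLE_8/3 curve Γ of Φ⁻¹(D); pushing through the Lipschitz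
map CurveClass.map Φ and adding the o(1) comparison, the ℤ² law in D converges to ν_D := law of Φ∘Γ
= Φ_*SLE(Φ⁻¹D) — for EVERY D and every approximation (SAW.exists_isEndpointApprox supplies one for
each D). QuarterTurnCovariance plus uniqueness of weak limits (TendstoLaw.unique; finiteness via
isProjectiveLimit_preWienerMeasure_holds) gives ν_(iD) = (z ↦ iz)_*ν_D, i.e. N = Φ⁻¹RΦ is a
covariance of the SLE_8/3 law family; SLE is covariant under the rotation R
(IsSLELaw.conformalCovariance_of_facts from IsSLECurve.map_eq and
JordanDomain.exists_hasBoundaryValue, with similarityConformalEquiv), so T = R⁻¹N = (r₁/r₂)·diag(1,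
(r₂/r₁)²) and hence diag(1, s), s = (r₂/r₁)², are covariances (MarkedDomain.map_map,
CurveClass.map_homeomorph_trans, Measure.map_map; uniqueness of the SLE law by IsSLECurve.map_eq for
the 'every μ' clause). StretchRigidity forces s = 1, so Φ = r₁·id is a similarity, ν_D = SLE(D), and
TendstoLaw to ν_D is ConvergesInLawToSLE (8/3) (AEMeasurable by SAW.aemeasurable_curve;
exists_isSLECurve for the SLE curve of D).

Rationale: WHY THIS LINE. Beffara2008Universal (§1–2, after LanglandsPouliotSaintaubin1994) isolates what an
embedding-blind argument can give — the scaling limit modulo an unidentified linear map — and what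
pins the map: an extra graph automorphism; DKKMO2020Rotational (Thm 1.9 then §4.1) executed exactly
this two-step shape for FK percolation (universality across isoradial deformations modulo M_(β,α),
then the order-4 rotation S_0). This route transposes that shape to the self-avoiding walk, where no
Yang–Baxter/integrable family contains the uniform ℤ² walk (GlazmanManolescu2019 p.1; barrier
NienhuisWeightsExcludeVertexSAW): the honeycomb lattice IS the brick-wall subgraph of ℤ² (delete the
vertical bond above (x,y) when x+y is odd), so hexagonal→square universality becomes a statement on
ONE graph along a positive exponential family in a bond weight t, re-tuned to criticality x_c(t),
with the modulus pinned by symmetry at both ends (√3 at t = 0 by the order-3 rotation of the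
honeycomb, 1 at t = 1 by the quarter-turn). Imported areas, with dictionary: linear response /
information geometry of exponential families (d/dt E_t[f] = Cov_t(f, score), score = (N_odd −
ρ(t)|γ|)/t because (log x_c)' = −ρ/t) and the Kadanoff–Ceva/Cardy lattice stress tensor
(KadanoffCeva1971; Cardy1996 §11.3 (11.17)–(11.18); ChelkakGlazmanSmirnov2016StressTensor on the
integrable hexagonal side): anisotropic bond perturbation = energy (tuned away along x_c(t)) +
stretch generator (the modulus flow) + irrelevant operators (CaraccioloEtAl2005, Δ₁ = 3/2). What it
does that prior routes do not: SAWHexUniversality wants (U) 'ℤ² law ≈ hex law' with NO modulus and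
no mechanism (its YBtoUniform is the universality hypothesis itself); here (U) is weakened to the
modulo-GL₂ form that the barrier audit of EmbeddingModulusUniqueness marks as NOT blocked, the
modulus is removed by a provable SLE lemma plus an exact lattice rotation (no rigidity conjecture as
in SAWRestrictionRigidity), and the weight homotopy supplies a first-order, Monte-Carlo-testable
mechanism.

RANKED CRUXES. #2 HexConjecture (crux) — Duminil-Copin–Smirnov 2012 Conjecture 1 verbatim (hexagonal
lattice δHex embedded by hexCenter, every Dobrushin domain and every hexagonal endpoint
approximation): the critical hexagonal SAW law (weight x_c^ℓ(γ), x_c = 1/√(2+√2)) converges to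
chordal SLE_8/3. Identical to route SAWHexUniversality's HexConjecture (shared item); it is the
unproved named fact Literature.Probability.RandomPlanarGeometry.SAW.HexSAWScalingLimit the mechanism
rests on, hence listed first (card item (3) HexConjInBW, here kept in hexagonal coordinates so that
no brick-wall boundary convention enters the top layer). [difficulty: open-problem] (why it might
fail: = DCS Conj. 1, open: the parafermion obeys only half of discrete Cauchy–Riemann (barrier
ParafermionicHalfCauchyRiemann); no tightness/arm bounds at x_c on Hex beyond sub-ballisticity
(arXiv:2310.17299); SLE_8/3 identified only given a conformally covariant limit (LSW04).)
[DuminilCopinSmirnov2012, LawlerSchrammWerner2004SAW, DuminilCopinHammond2013, arXiv:2310.17299,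
Literature.Barriers.CriticalPhenomena.ParafermionicHalfCauchyRiemann]
#3 ModulusUniversality (crux) — (LMU(0,1) of the card, hexagonal form) there exist r₁, r₂ > 0 such
that for the diagonal homeomorphism Φ(x+iy) = r₁x + i r₂y, every Dobrushin domain D and every ℤ²
endpoint approximation (a_δ, b_δ) of D there is a hexagonal endpoint approximation (a'_δ, b'_δ) of
Φ⁻¹(D) with ∫ f(curve) dP^ℤ²_(D,δ) − ∫ f(Φ∘curve) dP^Hex_(Φ⁻¹D,δ) → 0 (δ → 0+) for every bounded
continuous f on CurveClass ℂ. The modulus r₂/r₁ is NOT asserted (conjecturally any r₁ = r₂ works);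
(U) of SAWHexUniversality is the case Φ = id. This is the crux the Assembly consumes and the hardest
NEW step. [difficulty: open-problem] (why it might fail: the uniform ℤ² SAW lies in no integrable
family, so nothing known forces its lattice corrections into ONE linear map; the FK analogue (DKKMO
Thm 1.9, 'modulo M_(β,α)') needs the star–triangle coupling, absent for SAW (GM2019 control
partition functions only); needs tightness on both lattices.) [Beffara2008Universal,
LanglandsPouliotSaintaubin1994, DKKMO2020Rotational, GlazmanManolescu2019, KennedyLawler2013,
arXiv:2603.16318, Literature.Barriers.CriticalPhenomena.EmbeddingModulusUniqueness]
#4 BrickWallFlow (crux) — (the one-graph weight homotopy, LMU(t,1) for t ∈ [0,1)) on the FIXED graph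
ℤ² let N_odd(γ) be the number of vertical bonds {(x,y),(x,y+1)} with x+y odd used by γ, Z_n(t) = Σ
over n-step SAWs from 0 of t^N_odd, x_c(t) = 1/limsup Z_n(t)^(1/n) (so x_c(0) = 1/μ(honeycomb) =
1/√(2+√2) since the walks using no odd bond are exactly the brick-wall = honeycomb walks, and x_c(1)
= 1/μ(ℤ²)), and P^t_(Ω,δ) ∝ x_c(t)^|γ| t^N_odd(γ) on SAWs of Ω_δ. Claim: for every t ∈ [0,1) there
are r₁(t), r₂(t) > 0 such that, with Φ_t = diag(r₁, r₂), for every Dobrushin D and ℤ² endpoint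
approximation of D there are endpoints (a'_δ, b'_δ) approximating Φ_t⁻¹(D), with P^t eventually a
probability measure there, such that ∫ f(curve) dP^1_(D,δ) − ∫ f(Φ_t∘curve) dP^t_(Φ_t⁻¹D,δ) → 0 for
all bounded continuous f. Predicted endpoints of the modulus: r₂/r₁ = √3 at t = 0
(brick-to-regular-hexagon affinity diag(√3/2, 3/2)), → 1 as t → 1. Its t-derivative is the card's
Ward identity 'the centred odd-bond count generates vertical stretches'; at t = 1, D4-symmetrised,
'N_v − N_h generates the area-preserving stretch'. [difficulty: open-problem] (why it might fail:
the staggered (period-2) perturbation may couple to the walk's orientation parity and leave a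
non-geometric O(1) term in the limit covariance (then no diagonal Φ_t exists); t-continuity of
subsequential limits is open; near t = 0 the graph degenerates, where the hex anchor sits.)
[Cardy1996, KadanoffCeva1971, ChelkakGlazmanSmirnov2016StressTensor, doi:10.1063/1.533189,
DuminilCopinSmirnov2012, CaraccioloEtAl2005, Beffara2008Universal]
#5 OddBondDensity (crux) — (PatternLLN of the card at t = 1) under the critical chordal ℤ² SAW law
in a Dobrushin domain with any endpoint approximation, the fraction of steps that are odd vertical
bonds converges to 1/4 in probability: P_δ(|N_odd(γ) − |γ|/4| > ε|γ|) → 0 as δ → 0+ for every ε > 0.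
This is what makes the score of the weight family a CENTRED additive functional ((log x_c)'(t) =
−ρ(t)/t with ρ(1) = 1/4) and is the first rung of the pattern-equidistribution input every version
of the Ward mechanism needs; attackable with Kesten-pattern/bridge technology already in the tree
(SAWKestenPatterns, SAWPatternDensity, SAWBridges). [difficulty: L] (why it might fail: a ratio LLN
for a local pattern is open even for the counting measure (Madras–Slade Ch.7 p.229: pattern
frequencies not known to converge; Kesten gives only ≥ aN); a kink of the two-variable growth rate
at the symmetric point t = 1 is not excluded; the chordal law adds boundary/x_c-tail issues.)
[MadrasSlade1993, Kesten1963SAW, doi:10.1063/1.533189, LawlerSchrammWerner2004SAW]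
#9 StretchRigidity (support) — chordal SLE_8/3 admits no axis-stretch covariance: if s > 0 and, for
the homeomorphism Φ_s(x+iy) = x + i s y, the push-forward along Φ_s of every chordal SLE_8/3 law in
every Dobrushin domain D is a chordal SLE_8/3 law in Φ_s(D), then s = 1. (Beffara's 'an extra
automorphism pins the modulus' made a lemma about SLE; suggested proofs: iterate Φ_s (the covariance
set is a group), so diag(1, s^k)-images of a fixed domain degenerate while a scale-free statistic
such as the relative horizontal extent of the curve keeps its law — contradicts boundary non-hitting
of SLE_κ, κ ≤ 4, after a corridor/Beurling estimate; or compare the restriction formula P(γ avoids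
A) = Φ'_A^(5/8) on an explicit pair.) [difficulty: L] [Beffara2008Universal, RohdeSchramm2005,
LawlerSchrammWerner2003Restriction, Schramm2001Percolation, Lawler2005]
#9 QuarterTurnCovariance (support) — exact lattice symmetry, at every mesh: the critical δℤ² SAW law
in Ω from a to b, pushed to curves and rotated by z ↦ iz, IS the critical SAW law in iΩ from the
rotated sites (x,y) ↦ (−y,x) pushed to curves (graph automorphism of Ω_δ: mesh vertices,
closed-segment edge rule and the union-of-largest-components convention are all
rotation-equivariant; lengths and hence weights are preserved); and an endpoint approximation of D
rotates to one of D.map(z ↦ iz). Consumer-ready form of Beffara's order-4 symmetry input for the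
Assembly. [difficulty: provable-now] [Beffara2008Universal, LawlerSchrammWerner2004SAW,
Literature.Probability.RandomPlanarGeometry.ChordalFamily.IsLatticeSimilarityCovariant]

TWO-LAYER PLAN. Foreseen glued splits (nothing filed now; k ≤ 3, depth 1): ModulusUniversality ⇐
BrickWallFlowUniform (the flow with moduli bounded and equicontinuous in t on [0,1)) →
HexBWTransport (t = 0: brick-wall walk in ℤ²-conventions = hexagonal walk up to the affinity
diag(√3/2,3/2) and a boundary layer of width O(δ)) → ModulusUniversality. BrickWallFlow ⇐
WardIdentity(t) (fluctuation–response: lim_δ Cov_t(f(curve), (N_odd − ρ(t)|γ|)/t) = (log λ)'(t) ·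
∂_s E_t[f(Σ_s⁻¹ curve in Σ_s Ω)], Σ_s = diag(1,e^s), one non-universal function λ) → PatternLLN(t)
(ρ(t) exists as an in-probability density, natural-length tightness |γ|δ^(4/3)) → CriticalCurveC1
(x_c ∈ C¹(0,1], (log x_c)' = −ρ/t) → BrickWallFlow. OddBondDensity ⇐ counting-measure LLN
(differentiability of the two-variable growth rate at t = 1) → transfer to the chordal critical law
by bridge decomposition → OddBondDensity. StretchRigidity ⇐ orbit degeneration + boundary
non-hitting (κ ≤ 4) + corridor estimate, or the restriction-formula comparison.

KILL CRITERIA. ¬ModulusUniversality (a proof, or decisive numerics, that ℤ² and hexagonal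
subsequential limits differ by more than one linear map — e.g. observable-dependent anisotropy
ratios) closes the route `refuted:ModulusUniversality`. ¬BrickWallFlow at some t ∈ (0,1) kills the
homotopy engine and the Ward mechanism but not (LMU): pivot to a direct two-lattice comparison (then
this route should be closed `superseded --by route-CriticalPhenomena-SAWHexUniversality` unless a
new engine is named). ¬OddBondDensity (no LLN for the odd-bond fraction) kills the centring of the
score: pivot WardIdentity to subsequential densities. ¬HexConjecture refutes DCS Conjecture 1 and
every hex-anchored route at once. Proved elsewhere: SAWHexUniversality.LatticeUniversality gives
ModulusUniversality with Φ = id (r3 closes for free); SAWRestrictionRigidity's Rigidity +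
AxiomsOfLimit + LimitExists moot the pinning half; the conjunct itself moots everything.

NOT DECOMPOSED YET. The Ward identity itself and PatternLLN(t) for 0 < t < 1 (layer-2 children of
BrickWallFlow); eventual tightness (only the ∃δ₀ form, shared with
SAWRestrictionRigidity.EventualTight — the all-δ form is the refuted stmt-0772); the hex ↔
brick-wall boundary-layer transport at t = 0; regularity of x_c(t) (BCKM-type arguments,
doi:10.1063/1.533189); the value of the modulus r₂(t)/r₁(t) for 0 < t < 1 (never needed); anything
inside HexConjecture (routes SAWParafermion / SAWHexUniversality).

CHEAPEST FALSIFIER. A kit experiment at ONE interior point of the homotopy, t = 1/2: exact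
enumeration (n ≤ 40, t-weighted counts Z_n(t) and end-to-end moments) or pivot Monte Carlo of the
t-weighted ℤ² SAW at x_c(t): if the limit is a diagonal image of a rotation-invariant law then, for
the endpoint (X,Y), E[X⁴]/E[X²]² = E[Y⁴]/E[Y²]² and 3E[X²Y²] = (E[X⁴]E[Y⁴])^(1/2) asymptotically,
and the anisotropy ratio E[Y²]/E[X²] extracted from walks must agree with the one extracted from
strip correlation lengths in the two axis directions; a persistent observable-dependence refutes
BrickWallFlow (and makes ModulusUniversality implausible). Second cheapest: Kennedy-type pivot
sampling of WARD(1) on ℤ²: Cov(1_E, N_v − N_h) against c × (first-order variation of the SLE_8/3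
prediction of P(E) under the stretch diag(e^-s, e^s)) for left-passage events E at several points —
ONE fitted constant c must serve all events. Not run here (planner seat; kit not in this unit).

NUMBERS. x_c(0) = 1/√(2+√2) = 0.541196 (DuminilCopinSmirnov2012 Thm 1; BW ≅ honeycomb as graphs);
x_c(1) = 1/μ(ℤ²) ≈ 0.379052 (μ ≈ 2.638158, LawlerSchrammWerner2004SAW §3.1: 2.6 ≤ μ ≤ 2.7
rigorously); predicted moduli r₂/r₁: √3 = 1.732051 at t = 0 (affinity diag(√3/2, 3/2) brick wall →
regular honeycomb), 1 at t = 1; ρ(1) = 1/4 (odd vertical bonds are a quarter of all steps by the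
quarter-turn and unit-translation symmetries of the bulk); κ = 8/3; irrelevant-operator decay
exponent Δ₁ = 3/2 (CaraccioloEtAl2005). Items at open: 7 (4 cruxes, 2 support, 1 assembly).

DEFINITION REQUESTS. To replace the inline `let`s of BrickWallFlow / OddBondDensity by tree notions
(filed after open, `--for` the BrickWallFlow item): SAW.oddVerticalCount (number of vertical bonds
with x+y odd used by a lattice walk), SAW.criticalFugacityT (x_c(t) = 1/limsup Z_n(t)^(1/n)) and
SAW.brickWallLaw (the law ∝ x^|γ| t^N_odd on SAW.DomainSAW), topic
Literature/Probability/RandomPlanarGeometry. No cite facts wanted beyond the existing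
DuminilCopinSmirnov2012_thm1; literature want filed: doi:10.1063/1.533189 (BCKM 2000, acq-02375).

Novelty: Searches (2026-08-15): `lit frontier CriticalPhenomena --since 2020` (30 rows: SLE regularity, CLE
connectivities, hex SAW sub-ballisticity arXiv:2310.17299 — none on SAW lattice universality or
anisotropy); `lit bridges CriticalPhenomena --cross any` (30 generic survey bridges); `lit search
--source zbmath|crossref|s2 "anisotropic self-avoiding walk"` (4+10+10: Borgs–Chayes–King–Madras
2000 doi:10.1063/1.533189 anisotropic SAW critical curve; Guttmann–Wallace 1985 spiral SAW; Turban
1992 directed SAW — nothing on scaling limits modulo a linear map); `lit galaxy search "anisotropic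
self-avoiding" --star all` (panama 0; pdf/crabby timed out); `lit read arxiv:2603.16318` pp.1–3
(Manolescu–Mohanarangan 2026: FK Wulff crystal isotropy from DKKMO rotational invariance); `lit read
book:madras1993-self-avoiding-walk` Ch. 7 p. 229 (pattern frequencies open); local
searchd/OpenAlex/arXiv API unavailable or rate-limited this session (noted); plus the card's
searches (galaxy 'self-avoiding walks on the brick' 0; CGS arXiv:1604.06339 pp.4–5) and the refuter
novelty audit of 2026-08-15 (Cardy 1996 §11.3 read; DKKMO 2020 and MM26 read; grade
new-combination).
Nearest prior art found: DKKMO2020Rotational Thm 1.9 + §4.1 (FK percolation: universality across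
isoradial deformations modulo an explicit linear map M_(β,α) by track exchange, then the order-4
rotation pins isotropy) and Beffara2008Universal Prop. 4 / §2.2 (linear modulus of lattice limits;
an automorphism pins it); for SAW only Glaz  [refs: 10.1063/1.533189, 2310.17299, 2603.16318, 1604.06339, doi:10.1063/1.533189, arxiv:2603.16318, book:madras1993-self-avoiding-walk, GlazmanManolescu2019, KadanoffCeva1971, Cardy1996]

Barriers (technique_class: weight-homotopy linear-modulus fluctuation-response pinning): - technique_class: weight-homotopy linear-modulus fluctuation-response pinning
- Literature.Barriers.CriticalPhenomena.EmbeddingModulusUniqueness: engaged by design, not evaded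
blindly — ModulusUniversality and BrickWallFlow are 'modulo an unidentified (diagonal) linear map'
statements, the class the 2026-08-15 audit marks NOT blocked (cf. DKKMO Thm 1.9); the modulus is
removed only in the Assembly by the barrier's evasion (i), an exact lattice symmetry: the order-4
rotation (QuarterTurnCovariance) together with the SLE lemma StretchRigidity; for 0 < t < 1 the
limit is allowed to stay anisotropic.
- Literature.Barriers.CriticalPhenomena.NienhuisWeightsExcludeVertexSAW: respected — no local
observable identity is written on ℤ² at any t > 0; integrable input enters only at t = 0 through
HexConjecture.
- Literature.Barriers.CriticalPhenomena.ParafermionicHalfCauchyRiemann: applies in full to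
HexConjecture, which is quarantined as one undecomposed shared crux (business of SAWParafermion /
SAWHexUniversality); it does not; the bet is that the new content is (LMU) and its engine, and that
the route still converts the conjunct into 'Hex ⇒ ℤ²' if (H) never closes.
- Literature.Barriers.CriticalPhenomena.SAWNoUnitaryCFT: not engaged — 'stress tensor' is dictionary
only; the Ward statement is a covariance identity of positive measures along an exponential family
(no Virasoro representation, unitarity or reflection positivity; SAW is not RP, card
saw-not-reflection-positive).
- Literatu

History (route lifecycle, newest last):
- 2026-08-15T16:10:08Z · rev 1: restated Assembly (stmt-CriticalPhenomena-5795) — route-repair (glue): restate Assembly without the 3 Literature antecedents (exists_isSLECurve is open at kappa=8 in the tree but the assembly only needs exists_ (planner-rbadge-CriticalPhenomena-SAWBrickWallH-47e3383e-g4-0)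
- 2026-08-26T05:04:02Z · DORMANT — reconciler: no traction for 8.4 d (last activity item-evidence-added at 2026-08-17T19:39:23Z); parked, not closed — `ledger route dormant route-CriticalPhenomen (operator:999:1900885)

sub-problem: SAWScalingLimit · status: dormant · opened planner-plancard-CriticalPhenomena-SAWScaling-38da007b-0 2026-08-15T11:42:40Z · rev 3 · ledger route-CriticalPhenomena-SAWBrickWallHomotopy
GENERATED by the gate from the ledger (D-0016/17). Provers cite these decls: `theorem foo : Summit.CriticalPhenomena.SAWScalingLimit.Theses.SAWBrickWallHomotopy.<Decl> := …` in Summits/CriticalPhenomena/SAWScalingLimit/Theorems/<Name>.lean.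
-/

namespace Summit.CriticalPhenomena.SAWScalingLimit.Theses.SAWBrickWallHomotopy

open scoped BigOperators Topology Manifold Classical MeasureTheory ProbabilityTheory Matrix InnerProductSpace ComplexConjugate ContinuousMap
open Filter Set Function TopologicalSpace MeasureTheory

attribute [summit_statement] _root_.SAWScalingLimit

/-- item stmt-CriticalPhenomena-0808 · crux · rank 2 · open · by planner
why it might fail: = DCS 2012 Conj. 1, open: the parafermionic observable obeys only half of discrete Cauchy-Riemann (barrier ParafermionicHalfCauchyRiemann); no tightness/RSW input for hexagonal SAW at x_c (best: sub-ballisticity, arXiv:2310.17299); SLE_8/3 identified only for a conformally covariant limit (LSW04).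
sources: DuminilCopinSmirnov2012, §4 Conjecture 1 (held copy arXiv:1007.0575 p.7), LawlerSchrammWerner2004SAW, §1 and Prediction 1 (§4.1), DuminilCopinHammond2013, arXiv:2310.17299, Literature.Barriers.CriticalPhenomena.ParafermionicHalfCauchyRiemann, Literature.Probability.RandomPlanarGeometry.SAW.HexSAWScalingLimit
[crux] r3 (informal until defn HexSAWLaw lands): Duminil-Copin–Smirnov 2012 Conjecture 1 verbatim
(arXiv:1007.0575 p.9): let Ω ≠ ℂ be simply connected (here: a Dobrushin domain) with boundary points
a, b; Ω_δ the largest finite domain of δHex inside Ω, a_δ, b_δ the vertices of Ω_δ closest to a, b;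
for x = x_c = 1/√(2+√2) the law of the SAW γ_δ in (Ω_δ, a_δ, b_δ) with weight ∝ x^{ℓ(γ)} converges
as δ → 0 to chordal SLE(8/3) in Ω from a to b
(Literature.Probability.RandomPlanarGeometry.ConvergesInLawToSLE (8/3)). -/
@[route_item "route-CriticalPhenomena-SAWBrickWallHomotopy", crux]
def HexConjecture : Prop :=
  ∀ (D : Literature.Probability.RandomPlanarGeometry.DobrushinDomain) (a b : ℝ → Literature.Probability.LatticeModels.HexVertex), Literature.Probability.RandomPlanarGeometry.SAW.IsEmbEndpointApprox Literature.Probability.LatticeModels.hexGraph Literature.Probability.LatticeModels.hexCenter D a b → Literature.Probability.RandomPlanarGeometry.ConvergesInLawToSLE ((8 : NNReal) / 3) D (fun δ (γ : Literature.Probability.RandomPlanarGeometry.SAW.HexDomainSAW D.carrier δ (a δ) (b δ)) => γ.curve) (fun δ => Literature.Probability.RandomPlanarGeometry.SAW.hexSAWLaw D.carrier δ (a δ) (b δ))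

/-- item stmt-CriticalPhenomena-5790 · crux · rank 3 · open · by planner
why it might fail: Universality between two non-integrable embeddings is open: uniform Z2 SAW is in no Yang-Baxter family (GM2019: partition functions only); the FK analogue modulo a linear map (DKKMO Thm 2.1) needs a star-triangle coupling SAW lacks; as typed, same-mesh equality for ALL endpoint approx, no tightness.
sources: Beffara2008Universal, Prop. 4 and §2 (linear modulus; an automorphism pins it), LanglandsPouliotSaintaubin1994 (universality modulo a linear map g), DKKMO2020Rotational, universality theorem (Thm 2.1 of the held arXiv:2012.11672 text = 'Thm 1.9' of the route header) + the rotation step, GlazmanManolescu2019 (arXiv:1708.00395, Thm 1-3: Yang-Baxter weights, partition-function level), KennedyLawler2013 (arXiv:1109.3091), arXiv:2603.16318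
[crux] (LMU(0,1) of the card, hexagonal form) there exist r₁, r₂ > 0 such that for the diagonal
homeomorphism Φ(x+iy) = r₁x + i r₂y, every Dobrushin domain D and every ℤ² endpoint approximation
(a_δ, b_δ) of D there is a hexagonal endpoint approximation (a'_δ, b'_δ) of Φ⁻¹(D) with ∫ f(curve)
dP^ℤ²_(D,δ) − ∫ f(Φ∘curve) dP^Hex_(Φ⁻¹D,δ) → 0 (δ → 0+) for every bounded continuous f on CurveClass
ℂ. The modulus r₂/r₁ is NOT asserted (conjecturally any r₁ = r₂ works); (U) of SAWHexUniversality is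
the case Φ = id. This is the crux the Assembly consumes and the hardest NEW step. [difficulty:
open-problem] -/
@[route_item "route-CriticalPhenomena-SAWBrickWallHomotopy", crux]
def ModulusUniversality : Prop :=
  ∃ r₁ r₂ : ℝ, 0 < r₁ ∧ 0 < r₂ ∧ ∀ Φ : ℂ ≃ₜ ℂ, (∀ z : ℂ, Φ z = ((r₁ * z.re : ℝ) : ℂ) + ((r₂ * z.im : ℝ) : ℂ) * Complex.I) → ∀ (D : Literature.Probability.RandomPlanarGeometry.DobrushinDomain) (a b : ℝ → Literature.Probability.LatticeModels.Site 2), Literature.Probability.RandomPlanarGeometry.SAW.IsEndpointApprox D a b → ∃ a' b' : ℝ → Literature.Probability.LatticeModels.HexVertex, Literature.Probability.RandomPlanarGeometry.SAW.IsEmbEndpointApprox Literature.Probability.LatticeModels.hexGraph Literature.Probability.LatticeModels.hexCenter (D.map Φ.symm) a' b' ∧ ∀ f : BoundedContinuousFunction (Literature.Probability.RandomPlanarGeometry.CurveClass ℂ) ℝ, Filter.Tendsto (fun δ => (∫ γ, f γ.curve ∂(Literature.Probability.RandomPlanarGeometry.SAW.law D.carrier δ (a δ) (b δ))) - ∫ γ,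 f (Literature.Probability.RandomPlanarGeometry.CurveClass.map (Φ : C(ℂ, ℂ)) γ.curve) ∂(Literature.Probability.RandomPlanarGeometry.SAW.hexSAWLaw (D.map Φ.symm).carrier δ (a' δ) (b' δ))) (nhdsWithin 0 (Set.Ioi 0)) (nhds 0)

/-- item stmt-CriticalPhenomena-5791 · crux · rank 4 · open · by planner
why it might fail: A family of universality claims each as hard as ModulusUniversality: the period-2 staggered weight may leave a non-affine discrepancy (no diagonal Phi_t); no control of t-continuity of subsequential limits; x_c(t) Lipschitz only on (0,1] (GrimmettLi2019 Thm 8), not at t->0 where the hex anchor sits.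
sources: Beffara2008Universal, §1-2, BorgsEtAl2000 (doi:10.1063/1.533189; anisotropic step weights, critical curve; acq-02375 open), GrimmettLi2019 (arXiv:1804.05380, Thm 6 and Thm 8: weighted bridge/connective constants, Lipschitz in the weights), KadanoffCeva1971, Cardy1996, §11.3 (11.17)-(11.18), ChelkakGlazmanSmirnov2016StressTensor (arXiv:1604.06339)
[crux] (the one-graph weight homotopy, LMU(t,1) for t ∈ [0,1)) on the FIXED graph ℤ² let N_odd(γ) be
the number of vertical bonds {(x,y),(x,y+1)} with x+y odd used by γ, Z_n(t) = Σ over n-step SAWs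
from 0 of t^N_odd, x_c(t) = 1/limsup Z_n(t)^(1/n) (so x_c(0) = 1/μ(honeycomb) = 1/√(2+√2) since the
walks using no odd bond are exactly the brick-wall = honeycomb walks, and x_c(1) = 1/μ(ℤ²)), and
P^t_(Ω,δ) ∝ x_c(t)^|γ| t^N_odd(γ) on SAWs of Ω_δ. Claim: for every t ∈ [0,1) there are r₁(t), r₂(t)
> 0 such that, with Φ_t = diag(r₁, r₂), for every Dobrushin D and ℤ² endpoint approximation of D
there are endpoints (a'_δ, b'_δ) approximating Φ_t⁻¹(D), with P^t eventually a probability measure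
there, such that ∫ f(curve) dP^1_(D,δ) − ∫ f(Φ_t∘curve) dP^t_(Φ_t⁻¹D,δ) → 0 for all bounded
continuous f. Predicted endpoints of the modulus: r₂/r₁ = √3 at t = 0 (brick-to-regular-hexagon
affinity diag(√3/2, 3/2)), → 1 as t → 1. Its t-derivative is the card's Ward identity 'the centred
odd-bond count generates vertical stretches'; at t = 1, D4-symmetrised, 'N_v − N_h generates the
area-preserving stretch'. [difficulty: open-problem] -/
@[route_item "route-CriticalPhenomena-SAWBrickWallHomotopy", crux]
def BrickWallFlow : Prop :=
  ∀ t : ℝ, 0 ≤ t → t < 1 → let nodd : (G : SimpleGraph (Literature.Probability.LatticeModels.Site 2)) → (u v : Literature.Probability.LatticeModels.Site 2) → G.Walk u v → ℕ := fun _ _ _ p => p.darts.countP (fun d => decide (d.toProd.1 0 = d.toProd.2 0 ∧ (d.toProd.1 0 + min (d.toProd.1 1) (d.toProd.2 1)) % 2 = 1)); let xc : ℝ := (Filter.limsup (fun n : ℕ => (∑ v ∈ Literature.Probability.LatticeModels.box 2 n, ∑ p ∈ ((Literature.Probability.LatticeModels.zdGraph 2).finsetWalkLength n (0 : Literature.Probability.LatticeModels.Site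 2) v).filter (fun p => p.IsPath), t ^ (nodd _ _ _ p)) ^ (1 / (n : ℝ))) Filter.atTop)⁻¹; let P : (Ω : Set ℂ) → (δ : ℝ) → (u v : Literature.Probability.LatticeModels.Site 2) → MeasureTheory.Measure (Literature.Probability.RandomPlanarGeometry.SAW.DomainSAW Ω δ u v) := fun Ω δ u v => ((MeasureTheory.Measure.sum (fun γ : Literature.Probability.RandomPlanarGeometry.SAW.DomainSAW Ω δ u v => ENNReal.ofReal (xc ^ γ.length * t ^ (nodd _ _ _ γ.walk)) • MeasureTheory.Measure.dirac γ)) Set.univ)⁻¹ • MeasureTheory.Measure.sum (fun γ : Literature.Probability.RandomPlanarGeometry.SAW.DomainSAW Ω δ u v => ENNReal.ofReal (xc ^ γ.length * t ^ (nodd _ _ _ γ.walk)) • MeasureTheory.Measure.dirac γ); ∃ r₁ r₂ : ℝ, 0 < r₁ ∧ 0 < r₂ ∧ ∀ Φ : ℂ ≃ₜ ℂ, (∀ z : ℂ, Φ z = ((r₁ * z.re : ℝ) : ℂ) + ((r₂ * z.im : ℝ) : ℂ) * Complex.I) → ∀ (D : Literature.Probability.RandomPlanarGeometry.DobrushinDomain)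 (a b : ℝ → Literature.Probability.LatticeModels.Site 2), Literature.Probability.RandomPlanarGeometry.SAW.IsEndpointApprox D a b → ∃ a' b' : ℝ → Literature.Probability.LatticeModels.Site 2, Literature.Probability.RandomPlanarGeometry.SAW.IsEndpointApprox (D.map Φ.symm) a' b' ∧ (∀ᶠ δ in nhdsWithin 0 (Set.Ioi 0), MeasureTheory.IsProbabilityMeasure (P (D.map Φ.symm).carrier δ (a' δ) (b' δ))) ∧ ∀ f : BoundedContinuousFunction (Literature.Probability.RandomPlanarGeometry.CurveClass ℂ) ℝ, Filter.Tendsto (fun δ => (∫ γ, f γ.curve ∂(Literature.Probability.RandomPlanarGeometry.SAW.law D.carrier δ (a δ) (b δ))) - ∫ γ, f (Literature.Probability.RandomPlanarGeometry.CurveClass.map (Φ : C(ℂ, ℂ)) γ.curve) ∂(P (D.map Φ.symm).carrier δ (a' δ) (b' δ))) (nhdsWithin 0 (Set.Ioi 0)) (nhds 0)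

/-- item stmt-CriticalPhenomena-5792 · crux · rank 5 · open · by planner
why it might fail: No LLN for a pattern density is known even for uniform SAWs: Kesten gives only >= aN (Madras-Slade Thm 7.2.3); the density function is only log-concave, a flat top (first-order kink of the free energy at t=1) not excluded (Janse van Rensburg 2015 §3.3, Thm 5.19); chordal x_c-law adds open tightness.
sources: MadrasSlade1993, Ch. 7: p.229 (pattern frequencies open) and Thm 7.2.3 p.233 (Kesten's pattern theorem; tree: SAWPatternTheorem thm723, SAWPatternDensity lemma725), Kesten1963SAW, Jansevanrensburg2015, §3.3 (density functions: LLN iff free energy differentiable, flat pieces = first-order transitions) and Thm 5.19 (log-concave density function of a Kesten pattern), BorgsEtAl2000 (doi:10.1063/1.533189), DuminilCopinHammond2013 (sub-ballisticity; length vs displacement of the critical walk), LawlerSchrammWerner2004SAW, §3.1 and §3.4.2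
[crux] (PatternLLN of the card at t = 1) under the critical chordal ℤ² SAW law in a Dobrushin domain
with any endpoint approximation, the fraction of steps that are odd vertical bonds converges to 1/4
in probability: P_δ(|N_odd(γ) − |γ|/4| > ε|γ|) → 0 as δ → 0+ for every ε > 0. This is what makes the
score of the weight family a CENTRED additive functional ((log x_c)'(t) = −ρ(t)/t with ρ(1) = 1/4)
and is the first rung of the pattern-equidistribution input every version of the Ward mechanism
needs; attackable with Kesten-pattern/bridge technology already in the tree (SAWKestenPatterns,
SAWPatternDensity, SAWBridges). [difficulty: L] -/
@[route_item "route-CriticalPhenomena-SAWBrickWallHomotopy", crux]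
def OddBondDensity : Prop :=
  let nodd : (G : SimpleGraph (Literature.Probability.LatticeModels.Site 2)) → (u v : Literature.Probability.LatticeModels.Site 2) → G.Walk u v → ℕ := fun _ _ _ p => p.darts.countP (fun d => decide (d.toProd.1 0 = d.toProd.2 0 ∧ (d.toProd.1 0 + min (d.toProd.1 1) (d.toProd.2 1)) % 2 = 1)); ∀ (D : Literature.Probability.RandomPlanarGeometry.DobrushinDomain) (a b : ℝ → Literature.Probability.LatticeModels.Site 2), Literature.Probability.RandomPlanarGeometry.SAW.IsEndpointApprox D a b → ∀ ε : ℝ, 0 < ε → Filter.Tendsto (fun δ => Literature.Probability.RandomPlanarGeometry.SAW.law D.carrier δ (a δ) (b δ) {γ | ε * (γ.length : ℝ) < |(nodd _ _ _ γ.walk : ℝ) - (γ.length : ℝ) / 4|}) (nhdsWithin 0 (Set.Ioi 0)) (nhds 0)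

/-- item stmt-CriticalPhenomena-5793 · support · rank 9 · closed · proved by Summit.CriticalPhenomena.SAWScalingLimit.Cruxes.HexTransfer.PinTheShear.stub_stretchRigidity (prover) · by planner
sources: Beffara2008Universal, RohdeSchramm2005, LawlerSchrammWerner2003Restriction, Schramm2001Percolation, Lawler2005
[support] chordal SLE_8/3 admits no axis-stretch covariance: if s > 0 and, for the homeomorphism
Φ_s(x+iy) = x + i s y, the push-forward along Φ_s of every chordal SLE_8/3 law in every Dobrushin
domain D is a chordal SLE_8/3 law in Φ_s(D), then s = 1. (Beffara's 'an extra automorphism pins the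
modulus' made a lemma about SLE; suggested proofs: iterate Φ_s (the covariance set is a group), so
diag(1, s^k)-images of a fixed domain degenerate while a scale-free statistic such as the relative
horizontal extent of the curve keeps its law — contradicts boundary non-hitting of SLE_κ, κ ≤ 4,
after a corridor/Beurling estimate; or compare the restriction formula P(γ avoids A) = Φ'_A^(5/8) on
an explicit pair.) [difficulty: L] -/
@[route_item "route-CriticalPhenomena-SAWBrickWallHomotopy", crux]
def StretchRigidity : Prop :=
  ∀ s : ℝ, 0 < s → (∀ Φ : ℂ ≃ₜ ℂ, (∀ z : ℂ, Φ z = (z.re : ℂ) + ((s * z.im : ℝ) : ℂ) * Complex.I) → ∀ (D : Literature.Probability.RandomPlanarGeometry.DobrushinDomain) (μ : MeasureTheory.Measure (Literature.Probability.RandomPlanarGeometry.CurveClass ℂ)), Literature.Probability.RandomPlanarGeometry.IsSLELaw ((8 : NNReal) / 3) D μ → Literature.Probability.RandomPlanarGeometry.IsSLELaw ((8 : NNReal) / 3) (D.map Φ) (μ.map (Literature.Probability.RandomPlanarGeometry.CurveClass.map (Φ : C(ℂ, ℂ))))) → s = 1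

-- `StretchRigidity` holds: proved by `Summit.CriticalPhenomena.SAWScalingLimit.Cruxes.HexTransfer.PinTheShear.stub_stretchRigidity` (its module imports this route file, so no `_holds` link can be stated here).

/-- item stmt-CriticalPhenomena-5794 · support · rank 9 · closed · proved by Summit.CriticalPhenomena.SAWScalingLimit.Cruxes.HexTransfer.PinTheShear.stub_quarterTurnCovariance (prover) · by planner
sources: Beffara2008Universal, LawlerSchrammWerner2004SAW, Literature.Probability.RandomPlanarGeometry.ChordalFamily.IsLatticeSimilarityCovariant
[support] exact lattice symmetry, at every mesh: the critical δℤ² SAW law in Ω from a to b, pushed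
to curves and rotated by z ↦ iz, IS the critical SAW law in iΩ from the rotated sites (x,y) ↦ (−y,x)
pushed to curves (graph automorphism of Ω_δ: mesh vertices, closed-segment edge rule and the
union-of-largest-components convention are all rotation-equivariant; lengths and hence weights are
preserved); and an endpoint approximation of D rotates to one of D.map(z ↦ iz). Consumer-ready form
of Beffara's order-4 symmetry input for the Assembly. [difficulty: provable-now] -/
@[route_item "route-CriticalPhenomena-SAWBrickWallHomotopy", crux]
def QuarterTurnCovariance : Prop :=
  (∀ (Ω : Set ℂ) (δ : ℝ) (a b : Literature.Probability.LatticeModels.Site 2), ((Literature.Probability.RandomPlanarGeometry.SAW.law Ω δ a b).map (fun γ => γ.curve)).map (Literature.Probability.RandomPlanarGeometry.CurveClass.map (Literature.Probability.RandomPlanarGeometry.similarity Complex.I Complex.I_ne_zero 0 : C(ℂ, ℂ))) = (Literature.Probability.RandomPlanarGeometry.SAW.law ((Literature.Probability.RandomPlanarGeometry.similarity Complex.I Complex.I_ne_zero 0) '' Ω) δ ![-(a 1), a 0] ![-(b 1), b 0]).map (fun γ => γ.curve)) ∧ ∀ (D : Literature.Probability.RandomPlanarGeometry.DobrushinDomain)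 (a b : ℝ → Literature.Probability.LatticeModels.Site 2), Literature.Probability.RandomPlanarGeometry.SAW.IsEndpointApprox D a b → Literature.Probability.RandomPlanarGeometry.SAW.IsEndpointApprox (D.map (Literature.Probability.RandomPlanarGeometry.similarity Complex.I Complex.I_ne_zero 0)) (fun δ => ![-(a δ 1), a δ 0]) (fun δ => ![-(b δ 1), b δ 0])

-- `QuarterTurnCovariance` holds: proved by `Summit.CriticalPhenomena.SAWScalingLimit.Cruxes.HexTransfer.PinTheShear.stub_quarterTurnCovariance` (its module imports this route file, so no `_holds` link can be stated here).

-- earlier Assembly (stmt-CriticalPhenomena-5795, replaced 2026-08-15T16:10:08Z -> stmt-CriticalPhenomena-10313): retired by None — Literature.Probability.RandomPlanarGeometry.exists_isSLECurve → Literature.Probability.RandomPlanarGeometry.IsSLECurve.map_eq → Literature.Probability.RandomPlanarGeometry.JordanDomain.exists_hasBoundaryValue → HexConjecture → ModulusUniversality → StretchRigidity → Quar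
/-- item stmt-CriticalPhenomena-10313 · assembly · rank 1 · closed · proved by Summit.CriticalPhenomena.SAWScalingLimit.Cruxes.HexTransfer.PinTheShear.brickWall_assembly @ 15fe79a35f3a (prover) · by planner
sources: Beffara2008Universal, LawlerSchrammWerner2004SAW, DuminilCopinSmirnov2012, RohdeSchramm2005
[assembly] HexConjecture → ModulusUniversality → StretchRigidity → QuarterTurnCovariance →
SAWScalingLimit. Same assembly argument as the thesis' ## Assembly paragraph (push the hexagonal
SLE_8/3 limit of Φ⁻¹(D) through CurveClass.map Φ using ModulusUniversality; QuarterTurnCovariance +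
uniqueness of weak limits make Φ⁻¹RΦ a covariance of the SLE_8/3 law family; similarity covariance
of SLE reduces it to the axis stretch diag(1,(r₂/r₁)²); StretchRigidity forces r₁ = r₂, so Φ is a
similarity and the ℤ² limit is SLE_8/3(D)). The three Literature antecedents of rev 0
(exists_isSLECurve, IsSLECurve.map_eq, JordanDomain.exists_hasBoundaryValue) are removed from the
statement because the tree PROVES what the argument consumes: exists_isSLECurve_eightThirds
(RandomPlanarGeometry/SLEExistenceNeEightHolds), IsSLECurve.map_eq_holds (SLEUniquenessInLaw),
JordanDomain.exists_hasBoundaryValue_holds (CaratheodoryHalfPlaneProofs) — a prover imports those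
files; the general-κ fact exists_isSLECurve (open at κ = 8 in the tree) is not needed at κ = 8/3. -/
@[route_item "route-CriticalPhenomena-SAWBrickWallHomotopy", crux]
def Assembly : Prop :=
  HexConjecture → ModulusUniversality → StretchRigidity → QuarterTurnCovariance → SAWScalingLimit

-- `Assembly` holds: proved by `Summit.CriticalPhenomena.SAWScalingLimit.Cruxes.HexTransfer.PinTheShear.brickWall_assembly` @ 15fe79a35f3a (its module imports this route file, so no `_holds` link can be stated here).

/-! D-0027 §2.1 — DECIDING THEOREM (planner-authored via `route open/edit --closes-file`; by planner-rbadge-CriticalPhenomena-SAWBrickWallH-47e3383e-g4-0 2026-08-15T16:10:08Z):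
its hypotheses are this route's items and its conclusion the sub-problem Statement (glue_lint), and it elaborates with this file. -/

@[closes "route-CriticalPhenomena-SAWBrickWallHomotopy"] theorem closes (hH : HexConjecture) (hMU : ModulusUniversality) (_hBW : BrickWallFlow)
    (_hOB : OddBondDensity) (hS : StretchRigidity) (hQ : QuarterTurnCovariance) (hA : Assembly) :
    _root_.SAWScalingLimit :=
  hA hH hMU hS hQ

end Summit.CriticalPhenomena.SAWScalingLimit.Theses.SAWBrickWallHomotopy
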